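/-
Copyright (c) 2026 the pub-hodgecm-mathlib formalisation cell (harness21).  Prover seat hodgecm-mathlib-LH7-p03 (g3) on the road-(D) owner's deal (LH6-p04 (g3),
2026-09-02 07:27Z «TAKE HSHELL-GLUE★»); crux H413 = stmt-HodgeConjecture-24833; 2026-09-02.
-/
import Summits.HodgeConjecture.HodgeConjecture.Theorems.F0P3cStCharTSHohShellH      -- ★ p850219 ② HOH-SHELL-H (LH7-p04): `classOrbitalIntegralH_eq_of_prodHaar_spectral`
import Summits.HodgeConjecture.HodgeConjecture.Theorems.F0P3cStCharTSHF1HAdapter     -- ★ p849948 hF1H-ADAPTER (LH7-p04): `smoothTrace_cmPrincipalSeriesH_indicator_shell_eq_hF1H`; brings ★ `weylConj_mem_cmTorus_two`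
import Summits.HodgeConjecture.HodgeConjecture.Theorems.F0P3cStCharTSHohFlip         -- ★ p850188 HOH-FLIP (this seat): `classOrbitalIntegral_indicator_doubleCoset_eq_conj`, `weylElt_prod_one_mem_normalizer`
import Summits.HodgeConjecture.HodgeConjecture.Theorems.F0P3cStCharTSFH0Kit          -- ★ FH0-KIT (F0P2-p02): `isLocSmooth_indicator_doubleCoset_prod`
import HarnessLib

/-!
# F0 · P3c · line LH6 «StCharTS» — road (D) «DEEP-FL», brick «HSHELL-GLUE★»: the per-summand `H`-side closed forms `hOHj` of ★ p849876 at the ORIENTED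
# representatives `u ∈ F`, assembled from ② HOH-SHELL-H (★ p850219) ∘ hF1H-ADAPTER (★ p849948) at the Weyl flips `b_u = w₀ u₁ w₀⁻¹` and relabelled by HOH-FLIP (★ p850188)

Cell `pub/hodgecm-mathlib`, crux H413 = `stmt-HodgeConjecture-24833` (lane `--supports … --as helper`), route HCCMUnconditional; hand LH7-p03 (g3) on the road-(D)
owner's deal (LH6-p04 (g3), 07:27Z «TAKE HSHELL-GLUE★»).  THEOREMS ONLY, sorry-free, ★-only imports; no definition ∕ instance ∕ notation ∕ named fact.  HONEST LABEL:
HC_CM is proved only modulo the 7 printed citations (2 remaining: hLiu418 = stmt-HodgeConjecture-24832, h413 = stmt-HodgeConjecture-24833) until rung 0 closes;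
count-neutral plumbing for the (D-c) head «XIG-ASSEMBLY».

THE MATHEMATICS ([Rogawski1990, §4.9 (4.9.4) p. 56; §12.1 pp. 171–172; §12.7 Lemma 12.7.3 (proof) p. 195]).  For each oriented representative `u = (u₁, u₂) ∈ F ⊆ T₂ × U(Φ₁)_v`
of the coset cover, the flip `b_u := w₀ u₁ w₀⁻¹ ∈ T₂` (★ `weylConj_mem_cmTorus_two`) is `H`-dominant; ★ hF1H-ADAPTER gives the spectral closed form of the shell indicator
`𝟙_{K_H (b_u, u₂) K_H}` (`K_H = K_{2,n} × K₁`) on every `i_H(χ₂ ⊠ χ₁)` for the product of two auxiliary Haar measures `ν₂ ⊗ ν₁`, with the second coset at `ʷb_u = u₁`;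
★ ② HOH-SHELL-H turns that into the `hOHj` closed form of the orbital integrals for the organ's own Haar `ν_H` (any), with step function
`A_u·(𝟙_{(b_u,u₂)·S′} + 1·𝟙_{u·S′})`, `S′ = (T₂ ∩ K_{2,n}) × K₁`, `A_u = ν_H(K_{2,n} × U(Φ₁)_v)·#R_{2,u}·δ_{B₂}^{1∕2}(b_u)·μ_T(T₂ ∩ K_{2,v})∕μ_T(T₂ ∩ K_{2,n})`;
and ★ HOH-FLIP (`w = (w₀, 1)` normalises `K_H`, orbital integrals are class functions) moves the closed form to the oriented shell `𝟙_{K_H (u₁, u₂) K_H}` with the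
oriented coset first: `A_u·(𝟙_{u·S′} + 1·𝟙_{(b_u,u₂)·S′})` — the `hOHj` input of ★ `isLocalDeltaTransfer_doubleCosetSum_of_checklist` at `s := F`,
`g u := 𝟙_{K_H (u₁,u₂) K_H}`, `C u := u • ↑S′` (★ XIG-DATA's `hC` currency), `C′ u := (b_u, u₂) • ↑S′`, `κ_H u := A_u`, `κ′ u := 1`.

* §1 `smul_coe_eq_setOf` (`a • ↑S = {x | a⁻¹ x ∈ S}`), `weylConj_weylConj_eq` (`ʷ(ʷk) = k` on `T₂`), `prod_weylElt_one_conj` (`(w₀,1)(u₁,u₂)(w₀,1)⁻¹ = (w₀u₁w₀⁻¹, u₂)`);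
* §2 **`hShell_xig_of_hF1H`** — the clause for the FLIPPED shells, dominant coset first (② ∘ adapter), inputs: the organ frame of ② (`νH hmH μT hK₁lev`), the `H`-level
  (`𝓘₂ n K₁ w₀ hw₀ hKw hW2c` of the adapter; `hKw` in ★ p850013's full form), the reps `F` with their dominance triples `hdom` and transversals `R₂, hR₂`
  (★ p850152 `domGeneralH_weylConj_of_cover`);
* §3 **`hOHj_xig_of_hF1H`** — the clause for the ORIENTED shells, oriented coset first (§2 + ★ HOH-FLIP §1 + `add_comm`): `hOHj` of ★ p849876 at the letters above.

## References
* [Rogawski1990] J. D. Rogawski, *Automorphic Representations of Unitary Groups in Three Variables*, Ann. of Math. Stud. 123 (1990): §4.3 p. 43; §4.9 (4.9.4) pp. 54–56;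
  §12.1 pp. 171–172; §12.7 Lemma 12.7.3 (proof) p. 195.
* [Casselman1995] W. Casselman, *Introduction to the theory of admissible representations of 𝔭-adic reductive groups* (1995 notes), Prop. 1.4.4 p. 14; §3; §6.3.
-/

set_option autoImplicit false
-- the mandated namespace has the single-problem summit's repeated segment (`HodgeConjecture.HodgeConjecture`)
set_option linter.dupNamespace false

noncomputable section

open NumberField IsDedekindDomain MeasureTheory MeasureTheory.Measure Topology
open scoped Matrix MatrixGroups NNReal ENNReal Pointwise
open Literature.MeasureTheory.Group
open Literature.NumberTheory Literature.NumberTheory.Automorphic Literature.NumberTheory.Automorphic.UnitaryGroup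
open Literature.NumberTheory.Automorphic.UnitaryGroup.HeisRing Literature.NumberTheory.Automorphic.UnitaryGroup.LineRing
open Literature.NumberTheory.Rogawski1990 Literature.NumberTheory.GaloisRepresentations
open Summit.HodgeConjecture.HodgeConjecture.Cruxes.H413.F0P3cStCharTSHohShellH
open Summit.HodgeConjecture.HodgeConjecture.Cruxes.H413.F0P3cStCharTSHF1HAdapter
open Summit.HodgeConjecture.HodgeConjecture.Cruxes.H413.F0P3cStCharTSHohFlip
open Summit.HodgeConjecture.HodgeConjecture.Cruxes.H413.F0P3cStCharTSFH0Kit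

namespace Summit.HodgeConjecture.HodgeConjecture.Cruxes.H413.F0P3cStCharTSHshellGlue

/-! ## §1 Small algebra -/

/-- **`a • ↑S = {x | a⁻¹ x ∈ S}`** — the left coset of a subgroup in set-builder spelling (★ ② writes cosets this way; ★ XIG-DATA writes `u • ↑S′`). [cite: Rogawski1990, §4.3 p. 43] -/
theorem smul_coe_eq_setOf {G : Type*} [Group G] (a : G) (S : Subgroup G) :
    a • (S : Set G) = {x : G | a⁻¹ * x ∈ (S : Set G)} :=
  Set.ext fun _ => mem_leftCoset_iff a

/-- **`(w₀, 1)·(u₁, u₂)·(w₀, 1)⁻¹ = (w₀ u₁ w₀⁻¹, u₂)`** in `U(Φ₂)(L⁺_v) × U(Φ₁)(L⁺_v)`. [cite: Rogawski1990, §4.3 p. 43] -/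
theorem prod_weylElt_one_conj {A B : Type*} [Group A] [Group B] (w₀ a : A) (b : B) :
    ((w₀, (1 : B)) : A × B) * (a, b) * ((w₀, (1 : B)) : A × B)⁻¹ = (w₀ * a * w₀⁻¹, b) := by
  simp only [Prod.mk_mul_mk, Prod.inv_mk, inv_one, one_mul, mul_one]

variable (L : Type) [Field L] [NumberField L] [IsCMField L] (v : HeightOneSpectrum (𝓞 ↥(maximalRealSubfield L)))

/-- **`ʷ(ʷk) = k` on `T₂`** (the long Weyl element `w₀`, `↑w₀ = Φ₂`, reverses the diagonal twice; ★ `glDiagonal_rev_eq_weylConj_two`). [cite: Rogawski1990, §1.10 p. 9] -/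
theorem weylConj_weylConj_eq (w₀ : ↥(unitaryGroupOfForm (conjLocal L (IsCMField.complexConj L) v) (cmLocalForm L 2 v))) (hw₀ : Units.val (w₀ : GL (Fin 2) (LocalRing L v)) = cmLocalForm L 2 v) (k : ↥(cmBorelTriple L 2 v).M) :
    (⟨w₀ * (w₀ * (k : ↥(unitaryGroupOfForm (conjLocal L (IsCMField.complexConj L) v) (cmLocalForm L 2 v))) * w₀⁻¹) * w₀⁻¹,
        weylConj_mem_cmTorus_two L v w₀ hw₀ ⟨w₀ * (k : ↥(unitaryGroupOfForm (conjLocal L (IsCMField.complexConj L) v) (cmLocalForm L 2 v))) * w₀⁻¹, weylConj_mem_cmTorus_two L v w₀ hw₀ k⟩⟩ : ↥(cmBorelTriple L 2 v).M) = k := by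
  have hk2 : ∃ d : Fin 2 → (LocalRing L v)ˣ, glDiagonal 2 (LocalRing L v) d = ((k : ↥(unitaryGroupOfForm (conjLocal L (IsCMField.complexConj L) v) (cmLocalForm L 2 v))) : GL (Fin 2) (LocalRing L v)) := k.2
  obtain ⟨d, hd⟩ := hk2
  have h1 := glDiagonal_rev_eq_weylConj_two (conjLocal L (IsCMField.complexConj L) v) (cmLocalForm_eq_over L 2 v) w₀ hw₀ k hd
  have h2 := glDiagonal_rev_eq_weylConj_two (conjLocal L (IsCMField.complexConj L) v) (cmLocalForm_eq_over L 2 v) w₀ hw₀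
    ⟨w₀ * (k : ↥(unitaryGroupOfForm (conjLocal L (IsCMField.complexConj L) v) (cmLocalForm L 2 v))) * w₀⁻¹, weylConj_mem_cmTorus_two L v w₀ hw₀ k⟩ h1
  apply Subtype.ext
  apply Subtype.ext
  rw [← h2, ← hd]
  congr 1
  funext i
  simp only [Fin.rev_rev]

/-! ## §2 The clause for the FLIPPED shells (dominant coset first): ② HOH-SHELL-H ∘ hF1H-ADAPTER at `b_u = w₀ u₁ w₀⁻¹` -/

open scoped Classical in
set_option maxHeartbeats 4000000 in  -- statement-level `whnf` on the CM carriers (same class as ★ p850219 ∕ ★ p849876)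
set_option synthInstance.maxHeartbeats 400000 in
/-- **«HSHELL-GLUE», DOMINANT FORM.**  In ②'s frame (`ν_H` any Haar on `H_v`, `m_H` canonical on the `G`-regular classes, `μ_T` a Haar on `T₂`, `K₁ ≤ U(Φ₁)_v` compact open inside
the integral level), with the `U(Φ₂)`-level `K_{2,n} = 𝓘₂.K n` normalised by the long Weyl element `w₀` (★ p850013) and the adapter's W2-c datum `hW2c`: for every representative
`u ∈ F` whose flip `b_u = w₀ u₁ w₀⁻¹` carries F1-H's dominance triple (`hdom`, ★ p850152) and a transversal `R₂ u` (`hR₂`), the flipped shell `𝟙_{K_H (b_u, u₂) K_H}` satisfies the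
`hOHj` clause of ★ p849876 with the step function `A_u·(𝟙_{(b_u,u₂)·S′} + 1·𝟙_{u·S′})` (dominant coset first).
[cite: Rogawski1990, §4.9 (4.9.4) p. 56; §12.1 pp. 171–172; §12.7 Lemma 12.7.3 (proof) p. 195] [cite: Casselman1995, §3, §6.3] -/
theorem hShell_xig_of_hF1H
    [mHH : MeasurableSpace (((cmDatum L 2 (Matrix.of fun i j : Fin 2 => if i.val + j.val + 1 = 2 then (1 : L) else 0)).Local v) × ((cmDatum L 1 (Matrix.of fun i j : Fin 1 => if i.val + j.val + 1 = 1 then (1 : L) else 0)).Local v))] [BorelSpace (((cmDatum L 2 (Matrix.of fun i j : Fin 2 => if i.val + j.val + 1 = 2 then (1 : L) else 0)).Local v) × ((cmDatum L 1 (Matrix.of fun i j : Fin 1 => if i.val + j.val + 1 = 1 then (1 : L) else 0)).Local v))]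
    [∀ aH : (((cmDatum L 2 (Matrix.of fun i j : Fin 2 => if i.val + j.val + 1 = 2 then (1 : L) else 0)).Local v) × ((cmDatum L 1 (Matrix.of fun i j : Fin 1 => if i.val + j.val + 1 = 1 then (1 : L) else 0)).Local v)), MeasurableSpace ((((cmDatum L 2 (Matrix.of fun i j : Fin 2 => if i.val + j.val + 1 = 2 then (1 : L) else 0)).Local v) × ((cmDatum L 1 (Matrix.of fun i j : Fin 1 => if i.val + j.val + 1 = 1 then (1 : L) else 0)).Local v)) ⧸ Subgroup.centralizer ({aH} : Set (((cmDatum L 2 (Matrix.of fun i j : Fin 2 => if i.val + j.val + 1 = 2 then (1 : L) else 0)).Local v) × ((cmDatum L 1 (Matrix.of fun i j : Fin 1 => if i.val + j.val + 1 = 1 then (1 : L) else 0)).Local v))))]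
    [∀ aH : (((cmDatum L 2 (Matrix.of fun i j : Fin 2 => if i.val + j.val + 1 = 2 then (1 : L) else 0)).Local v) × ((cmDatum L 1 (Matrix.of fun i j : Fin 1 => if i.val + j.val + 1 = 1 then (1 : L) else 0)).Local v)), BorelSpace ((((cmDatum L 2 (Matrix.of fun i j : Fin 2 => if i.val + j.val + 1 = 2 then (1 : L) else 0)).Local v) × ((cmDatum L 1 (Matrix.of fun i j : Fin 1 => if i.val + j.val + 1 = 1 then (1 : L) else 0)).Local v)) ⧸ Subgroup.centralizer ({aH} : Set (((cmDatum L 2 (Matrix.of fun i j : Fin 2 => if i.val + j.val + 1 = 2 then (1 : L) else 0)).Local v) × ((cmDatum L 1 (Matrix.of fun i j : Fin 1 => if i.val + j.val + 1 = 1 then (1 : L) else 0)).Local v))))]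
    [MeasurableSpace ↥(unitaryGroupOfForm (conjLocal L (IsCMField.complexConj L) v) (cmLocalForm L 2 v))] [BorelSpace ↥(unitaryGroupOfForm (conjLocal L (IsCMField.complexConj L) v) (cmLocalForm L 2 v))] [MeasurableSpace ((cmDatum L 1 (Matrix.of fun i j : Fin 1 => if i.val + j.val + 1 = 1 then (1 : L) else 0)).Local v)] [BorelSpace ((cmDatum L 1 (Matrix.of fun i j : Fin 1 => if i.val + j.val + 1 = 1 then (1 : L) else 0)).Local v)]
    (w : PlacesOver L v) (hw : IsCMField.complexConj L • w.1 = w.1)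
    (νH : Measure (((cmDatum L 2 (Matrix.of fun i j : Fin 2 => if i.val + j.val + 1 = 2 then (1 : L) else 0)).Local v) × ((cmDatum L 1 (Matrix.of fun i j : Fin 1 => if i.val + j.val + 1 = 1 then (1 : L) else 0)).Local v))) [νH.IsHaarMeasure] [νH.IsMulRightInvariant]
    {mH : OrbitalMeasureFamily (((cmDatum L 2 (Matrix.of fun i j : Fin 2 => if i.val + j.val + 1 = 2 then (1 : L) else 0)).Local v) × ((cmDatum L 1 (Matrix.of fun i j : Fin 1 => if i.val + j.val + 1 = 1 then (1 : L) else 0)).Local v))} (hmH : mH.IsCanonical (IsLocalGRegular L v) νH)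
    (μT : Measure ↥(cmBorelTriple L 2 v).M) [μT.IsHaarMeasure]
    (hK₁lev : ∀ x : ((cmDatum L 1 (Matrix.of fun i j : Fin 1 => if i.val + j.val + 1 = 1 then (1 : L) else 0)).Local v), x ∈ cmLocalIntegralLevel L 1 (Matrix.of fun i j : Fin 1 => if i.val + j.val + 1 = 1 then (1 : L) else 0) v)
    (𝓘₂ : (cmBorelTriple L 2 v).IwahoriDatum) (n : ℕ)
    (K₁ : Subgroup ((cmDatum L 1 (Matrix.of fun i j : Fin 1 => if i.val + j.val + 1 = 1 then (1 : L) else 0)).Local v)) (hK₁o : IsOpen (K₁ : Set ((cmDatum L 1 (Matrix.of fun i j : Fin 1 => if i.val + j.val + 1 = 1 then (1 : L) else 0)).Local v))) (hK₁c : IsCompact (K₁ : Set ((cmDatum L 1 (Matrix.of fun i j : Fin 1 => if i.val + j.val + 1 = 1 then (1 : L) else 0)).Local v)))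
    (w₀ : ↥(unitaryGroupOfForm (conjLocal L (IsCMField.complexConj L) v) (cmLocalForm L 2 v))) (hw₀ : Units.val (w₀ : GL (Fin 2) (LocalRing L v)) = cmLocalForm L 2 v)
    (hKw : ∀ κ ∈ 𝓘₂.K n, w₀ * κ * w₀⁻¹ ∈ 𝓘₂.K n)
    (hW2c : haveI := locallyCompactSpace_cmBorelU L 2 v
      ∀ (χ₁ : (LocalRing L v)ˣ →* ℂˣ) (χ₂ : ↥(normOneUnits (conjLocal L (IsCMField.complexConj L) v)) →* ℂˣ),
        Continuous (fun x => ((χ₁ x : ℂˣ) : ℂ)) → Continuous (fun x => ((χ₂ x : ℂˣ) : ℂ)) →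
        FiniteDimensional ℂ ((cmBorelTriple L 2 v).restrict (cmPrincipalSeries L 2 v
            (torusCharPair (conjLocal L (IsCMField.complexConj L) v) (cmLocalForm L 2 v) (cmLocalForm_eq_over L 2 v) 0 χ₁ χ₂))).Coinvariants ∧
        Module.finrank ℂ ((cmBorelTriple L 2 v).restrict (cmPrincipalSeries L 2 v
            (torusCharPair (conjLocal L (IsCMField.complexConj L) v) (cmLocalForm L 2 v) (cmLocalForm_eq_over L 2 v) 0 χ₁ χ₂))).Coinvariants = 2 ∧
        ∃ ℓ : Submodule ℂ ((cmBorelTriple L 2 v).restrict (cmPrincipalSeries L 2 v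
            (torusCharPair (conjLocal L (IsCMField.complexConj L) v) (cmLocalForm L 2 v) (cmLocalForm_eq_over L 2 v) 0 χ₁ χ₂))).Coinvariants,
          Module.finrank ℂ ↥ℓ = 1 ∧
          (∀ (m : ↥(cmBorelTriple L 2 v).M), ∀ x ∈ ℓ,
            (cmPrincipalSeries L 2 v (torusCharPair (conjLocal L (IsCMField.complexConj L) v) (cmLocalForm L 2 v) (cmLocalForm_eq_over L 2 v) 0 χ₁ χ₂)).normalizedJacquet
                (cmBorelTriple L 2 v) m x =
              ((weylTorusCharPair (conjLocal L (IsCMField.complexConj L) v) (cmLocalForm L 2 v) (cmLocalForm_eq_over L 2 v) 0 χ₁ χ₂ m : ℂˣ) : ℂ) • x) ∧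
          (∀ (m : ↥(cmBorelTriple L 2 v).M) (x : ((cmBorelTriple L 2 v).restrict (cmPrincipalSeries L 2 v
              (torusCharPair (conjLocal L (IsCMField.complexConj L) v) (cmLocalForm L 2 v) (cmLocalForm_eq_over L 2 v) 0 χ₁ χ₂))).Coinvariants),
            (cmPrincipalSeries L 2 v (torusCharPair (conjLocal L (IsCMField.complexConj L) v) (cmLocalForm L 2 v) (cmLocalForm_eq_over L 2 v) 0 χ₁ χ₂)).normalizedJacquet
                (cmBorelTriple L 2 v) m x -
              ((torusCharPair (conjLocal L (IsCMField.complexConj L) v) (cmLocalForm L 2 v) (cmLocalForm_eq_over L 2 v) 0 χ₁ χ₂ m : ℂˣ) : ℂ) • x ∈ ℓ))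
    (F : Finset (↥(cmBorelTriple L 2 v).M × ((cmDatum L 1 (Matrix.of fun i j : Fin 1 => if i.val + j.val + 1 = 1 then (1 : L) else 0)).Local v)))
    (hdom : ∀ u ∈ F,
      (∀ x ∈ 𝓘₂.K n ⊓ (cmBorelTriple L 2 v).N, (w₀ * (u.1 : ↥(unitaryGroupOfForm (conjLocal L (IsCMField.complexConj L) v) (cmLocalForm L 2 v))) * w₀⁻¹) * x * (w₀ * (u.1 : ↥(unitaryGroupOfForm (conjLocal L (IsCMField.complexConj L) v) (cmLocalForm L 2 v))) * w₀⁻¹)⁻¹ ∈ 𝓘₂.K n) ∧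
      (∀ x ∈ 𝓘₂.K n ⊓ 𝓘₂.Nbar, (w₀ * (u.1 : ↥(unitaryGroupOfForm (conjLocal L (IsCMField.complexConj L) v) (cmLocalForm L 2 v))) * w₀⁻¹)⁻¹ * x * (w₀ * (u.1 : ↥(unitaryGroupOfForm (conjLocal L (IsCMField.complexConj L) v) (cmLocalForm L 2 v))) * w₀⁻¹) ∈ 𝓘₂.K n ⊓ 𝓘₂.Nbar) ∧
      (∀ x ∈ (cmBorelTriple L 2 v).N, ∃ m : ℕ, ∀ m', m ≤ m' → (w₀ * (u.1 : ↥(unitaryGroupOfForm (conjLocal L (IsCMField.complexConj L) v) (cmLocalForm L 2 v))) * w₀⁻¹) ^ m' * x * ((w₀ * (u.1 : ↥(unitaryGroupOfForm (conjLocal L (IsCMField.complexConj L) v) (cmLocalForm L 2 v))) * w₀⁻¹) ^ m')⁻¹ ∈ 𝓘₂.K n))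
    (R₂ : (↥(cmBorelTriple L 2 v).M × ((cmDatum L 1 (Matrix.of fun i j : Fin 1 => if i.val + j.val + 1 = 1 then (1 : L) else 0)).Local v)) → Finset ↥(unitaryGroupOfForm (conjLocal L (IsCMField.complexConj L) v) (cmLocalForm L 2 v)))
    (hR₂ : ∀ u ∈ F, IsLeftTransversal (𝓘₂.K n) (𝓘₂.K n ⊓ ConjAct.toConjAct (w₀ * (u.1 : ↥(unitaryGroupOfForm (conjLocal L (IsCMField.complexConj L) v) (cmLocalForm L 2 v))) * w₀⁻¹) • 𝓘₂.K n) (R₂ u)) :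
    ∀ u ∈ F, ∀ (γH : (((cmDatum L 2 (Matrix.of fun i j : Fin 2 => if i.val + j.val + 1 = 2 then (1 : L) else 0)).Local v) × ((cmDatum L 1 (Matrix.of fun i j : Fin 1 => if i.val + j.val + 1 = 1 then (1 : L) else 0)).Local v)))
      (d' : Fin 2 → (LocalRing L v)ˣ), glDiagonal 2 (LocalRing L v) d' = ((γH.1).val : GL (Fin 2) (LocalRing L v)) → IsLocalGRegular L v γH →
      Valued.v (((d' 1 : (LocalRing L v)ˣ) : LocalRing L v) w) < Valued.v (((d' 0 : (LocalRing L v)ˣ) : LocalRing L v) w) →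
      galAdicCompletionMap (L := L) (IsCMField.complexConj L) hw (((d' 0 : (LocalRing L v)ˣ) : LocalRing L v) w) * ((d' 1 : (LocalRing L v)ˣ) : LocalRing L v) w = 1 →
      ∀ (tH : ↥(cmBorelTriple L 2 v).M), (tH : ↥(unitaryGroupOfForm (conjLocal L (IsCMField.complexConj L) v) (cmLocalForm L 2 v))) = γH.1 →
      ∀ (hdH : glDiagonal 2 (LocalRing L v) d' = ((tH : ↥(unitaryGroupOfForm (conjLocal L (IsCMField.complexConj L) v) (cmLocalForm L 2 v))) : GL (Fin 2) (LocalRing L v)))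
        (hb : IsUnit ((((d' 0)⁻¹ * d' 1 : (LocalRing L v)ˣ) : LocalRing L v) - 1)),
      haveI := locallyCompactSpace_cmBorelU L 2 v
      classOrbitalIntegral mH ((DoubleCoset.doubleCoset (((w₀ * (u.1 : ↥(unitaryGroupOfForm (conjLocal L (IsCMField.complexConj L) v) (cmLocalForm L 2 v))) * w₀⁻¹), u.2) : (↥(unitaryGroupOfForm (conjLocal L (IsCMField.complexConj L) v) (cmLocalForm L 2 v)) × ((cmDatum L 1 (Matrix.of fun i j : Fin 1 => if i.val + j.val + 1 = 1 then (1 : L) else 0)).Local v))) ((((𝓘₂.K n).prod K₁ : Subgroup (↥(unitaryGroupOfForm (conjLocal L (IsCMField.complexConj L) v) (cmLocalForm L 2 v)) × ((cmDatum L 1 (Matrix.of fun i j : Fin 1 => if i.val + j.val + 1 = 1 then (1 : L) else 0)).Local v)))) : Set (↥(unitaryGroupOfForm (conjLocal L (IsCMField.complexConj L) v) (cmLocalForm L 2 v)) × ((cmDatum L 1 (Matrix.of fun i j : Fin 1 => if i.val + j.val + 1 = 1 then (1 : L) else 0)).Local v))) (((𝓘₂.K n).prod K₁ : Subgroup (↥(unitaryGroupOfForm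 (conjLocal L (IsCMField.complexConj L) v) (cmLocalForm L 2 v)) × ((cmDatum L 1 (Matrix.of fun i j : Fin 1 => if i.val + j.val + 1 = 1 then (1 : L) else 0)).Local v))))).indicator fun _ => (1 : ℂ)) (ConjClasses.mk (((tH : ↥(unitaryGroupOfForm (conjLocal L (IsCMField.complexConj L) v) (cmLocalForm L 2 v))) :
          ((cmDatum L 2 (Matrix.of fun i j : Fin 2 => if i.val + j.val + 1 = 2 then (1 : L) else 0)).Local v)), γH.2)) =
        ((rootDeltaChar (cmBorelTriple L 2 v).P ⟨(tH : ↥(unitaryGroupOfForm (conjLocal L (IsCMField.complexConj L) v) (cmLocalForm L 2 v))), (cmBorelTriple L 2 v).M_le tH.2⟩ : ℂˣ) : ℂ)⁻¹ *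
          (((letI : MeasurableSpace (LocalRing L v) := borel _; haveI : BorelSpace (LocalRing L v) := ⟨rfl⟩
            haveI : SecondCountableTopology (LocalRing L v) := secondCountableTopology_localRing (E := L) v
            ((HeisRing.skewModulus (conjLocal L (IsCMField.complexConj L) v) (continuous_conjLocal L (IsCMField.complexConj L) v) hb.unit
              (LineRing.map_unit_torusScalar_sub_one_two (conjLocal L (IsCMField.complexConj L) v) (cmLocalForm_eq_over L 2 v)
                (⟨(tH : ↥(unitaryGroupOfForm (conjLocal L (IsCMField.complexConj L) v) (cmLocalForm L 2 v))), tH.2⟩ :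
                  ↥(torusU (conjLocal L (IsCMField.complexConj L) v) (cmLocalForm L 2 v))) hdH hb))⁻¹ : ℝ≥0)) : ℝ) : ℂ) *
          ((((νH.real ((((𝓘₂.K n).prod (⊤ : Subgroup ((cmDatum L 1 (Matrix.of fun i j : Fin 1 => if i.val + j.val + 1 = 1 then (1 : L) else 0)).Local v)) : Subgroup (↥(unitaryGroupOfForm (conjLocal L (IsCMField.complexConj L) v) (cmLocalForm L 2 v)) × ((cmDatum L 1 (Matrix.of fun i j : Fin 1 => if i.val + j.val + 1 = 1 then (1 : L) else 0)).Local v))) : Set (↥(unitaryGroupOfForm (conjLocal L (IsCMField.complexConj L) v) (cmLocalForm L 2 v)) × ((cmDatum L 1 (Matrix.of fun i j : Fin 1 => if i.val + j.val + 1 = 1 then (1 : L) else 0)).Local v)))) : ℝ) : ℂ) * ((R₂ u).card : ℂ) * (((rootDeltaChar (cmBorelTriple L 2 v).P (Subgroup.inclusion (cmBorelTriple L 2 v).M_le ⟨(w₀ * (u.1 : ↥(unitaryGroupOfForm (conjLocal L (IsCMField.complexConj L) v) (cmLocalForm L 2 v))) * w₀⁻¹), (weylConj_mem_cmTorus_two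 L v w₀ hw₀ u.1)⟩)) : ℂˣ) : ℂ) *
              ((μT.real {t : ↥(cmBorelTriple L 2 v).M | (t : ↥(unitaryGroupOfForm (conjLocal L (IsCMField.complexConj L) v) (cmLocalForm L 2 v))) ∈ cmLocalIntegralLevel L 2 (Matrix.of fun i j : Fin 2 => if i.val + j.val + 1 = 2 then (1 : L) else 0) v} : ℝ) : ℂ) /
              ((μT.real ((((𝓘₂.K n).comap (cmBorelTriple L 2 v).M.subtype : Subgroup ↥(cmBorelTriple L 2 v).M)) : Set ↥(cmBorelTriple L 2 v).M) : ℝ) : ℂ)) * ((((((⟨(w₀ * (u.1 : ↥(unitaryGroupOfForm (conjLocal L (IsCMField.complexConj L) v) (cmLocalForm L 2 v))) * w₀⁻¹), (weylConj_mem_cmTorus_two L v w₀ hw₀ u.1)⟩ : ↥(cmBorelTriple L 2 v).M), u.2) : (↥(cmBorelTriple L 2 v).M × ((cmDatum L 1 (Matrix.of fun i j : Fin 1 => if i.val + j.val + 1 = 1 then (1 : L) else 0)).Local v))) • ((((𝓘₂.K n).comap (cmBorelTriple L 2 v).M.subtype).prod K₁ : Subgroup (↥(cmBorelTriple L 2 v).M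 × ((cmDatum L 1 (Matrix.of fun i j : Fin 1 => if i.val + j.val + 1 = 1 then (1 : L) else 0)).Local v))) : Set (↥(cmBorelTriple L 2 v).M × ((cmDatum L 1 (Matrix.of fun i j : Fin 1 => if i.val + j.val + 1 = 1 then (1 : L) else 0)).Local v))))).indicator (fun _ => (1 : ℂ)) (tH, γH.2) + 1 * ((u • ((((𝓘₂.K n).comap (cmBorelTriple L 2 v).M.subtype).prod K₁ : Subgroup (↥(cmBorelTriple L 2 v).M × ((cmDatum L 1 (Matrix.of fun i j : Fin 1 => if i.val + j.val + 1 = 1 then (1 : L) else 0)).Local v))) : Set (↥(cmBorelTriple L 2 v).M × ((cmDatum L 1 (Matrix.of fun i j : Fin 1 => if i.val + j.val + 1 = 1 then (1 : L) else 0)).Local v))))).indicator (fun _ => (1 : ℂ)) (tH, γH.2))) := by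
  intro u hu γH d' hd' hreg hlt h01 tH htH hdH hb
  haveI := locallyCompactSpace_cmBorelU L 2 v
  -- §0 carriers ∕ instances (both spellings of the `U(Φ₂)` factor)
  letI : MeasurableSpace ((cmDatum L 2 (Matrix.of fun i j : Fin 2 => if i.val + j.val + 1 = 2 then (1 : L) else 0)).Local v) := ‹MeasurableSpace ↥(unitaryGroupOfForm (conjLocal L (IsCMField.complexConj L) v) (cmLocalForm L 2 v))›
  haveI : BorelSpace ((cmDatum L 2 (Matrix.of fun i j : Fin 2 => if i.val + j.val + 1 = 2 then (1 : L) else 0)).Local v) := ‹BorelSpace ↥(unitaryGroupOfForm (conjLocal L (IsCMField.complexConj L) v) (cmLocalForm L 2 v))›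
  haveI : LocallyCompactSpace ↥(unitaryGroupOfForm (conjLocal L (IsCMField.complexConj L) v) (cmLocalForm L 2 v)) := locallyCompactSpace_local (IsCMField.complexConj L) 2 _ v
  haveI : SecondCountableTopology ↥(unitaryGroupOfForm (conjLocal L (IsCMField.complexConj L) v) (cmLocalForm L 2 v)) := secondCountableTopology_local (IsCMField.complexConj L) 2 _ v
  haveI : T2Space ↥(unitaryGroupOfForm (conjLocal L (IsCMField.complexConj L) v) (cmLocalForm L 2 v)) := t2Space_cmDatum_local 2 L (Matrix.of fun i j : Fin 2 => if i.val + j.val + 1 = 2 then (1 : L) else 0) v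
  haveI : NonarchimedeanGroup ↥(unitaryGroupOfForm (conjLocal L (IsCMField.complexConj L) v) (cmLocalForm L 2 v)) := nonarchimedeanGroup_cmLocal L 2 v
  haveI : LocallyCompactSpace ((cmDatum L 1 (Matrix.of fun i j : Fin 1 => if i.val + j.val + 1 = 1 then (1 : L) else 0)).Local v) := locallyCompactSpace_local (IsCMField.complexConj L) 1 _ v
  haveI : SecondCountableTopology ((cmDatum L 1 (Matrix.of fun i j : Fin 1 => if i.val + j.val + 1 = 1 then (1 : L) else 0)).Local v) := secondCountableTopology_local (IsCMField.complexConj L) 1 _ v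
  haveI : T2Space ((cmDatum L 1 (Matrix.of fun i j : Fin 1 => if i.val + j.val + 1 = 1 then (1 : L) else 0)).Local v) := t2Space_cmDatum_local 1 L (Matrix.of fun i j : Fin 1 => if i.val + j.val + 1 = 1 then (1 : L) else 0) v
  haveI : NonarchimedeanGroup ((cmDatum L 1 (Matrix.of fun i j : Fin 1 => if i.val + j.val + 1 = 1 then (1 : L) else 0)).Local v) := nonarchimedeanGroup_cmLocal L 1 v
  haveI : LocallyCompactSpace ((cmDatum L 2 (Matrix.of fun i j : Fin 2 => if i.val + j.val + 1 = 2 then (1 : L) else 0)).Local v) := ‹LocallyCompactSpace ↥(unitaryGroupOfForm (conjLocal L (IsCMField.complexConj L) v) (cmLocalForm L 2 v))›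
  haveI : SecondCountableTopology ((cmDatum L 2 (Matrix.of fun i j : Fin 2 => if i.val + j.val + 1 = 2 then (1 : L) else 0)).Local v) := ‹SecondCountableTopology ↥(unitaryGroupOfForm (conjLocal L (IsCMField.complexConj L) v) (cmLocalForm L 2 v))›
  haveI : T2Space ((cmDatum L 2 (Matrix.of fun i j : Fin 2 => if i.val + j.val + 1 = 2 then (1 : L) else 0)).Local v) := ‹T2Space ↥(unitaryGroupOfForm (conjLocal L (IsCMField.complexConj L) v) (cmLocalForm L 2 v))›
  haveI : NonarchimedeanGroup ((cmDatum L 2 (Matrix.of fun i j : Fin 2 => if i.val + j.val + 1 = 2 then (1 : L) else 0)).Local v) := ‹NonarchimedeanGroup ↥(unitaryGroupOfForm (conjLocal L (IsCMField.complexConj L) v) (cmLocalForm L 2 v))›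
  haveI : T1Space (LocalRing L v) := inferInstance
  haveI : SigmaCompactSpace ((cmDatum L 2 (Matrix.of fun i j : Fin 2 => if i.val + j.val + 1 = 2 then (1 : L) else 0)).Local v) := sigmaCompactSpace_of_locallyCompact_secondCountable
  haveI : SigmaCompactSpace ((cmDatum L 1 (Matrix.of fun i j : Fin 1 => if i.val + j.val + 1 = 1 then (1 : L) else 0)).Local v) := sigmaCompactSpace_of_locallyCompact_secondCountable
  -- the Borel structure `mHH` IS the product structure
  have hmeq : mHH = @Prod.instMeasurableSpace ((cmDatum L 2 (Matrix.of fun i j : Fin 2 => if i.val + j.val + 1 = 2 then (1 : L) else 0)).Local v) ((cmDatum L 1 (Matrix.of fun i j : Fin 1 => if i.val + j.val + 1 = 1 then (1 : L) else 0)).Local v) _ _ :=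
    (‹BorelSpace (((cmDatum L 2 (Matrix.of fun i j : Fin 2 => if i.val + j.val + 1 = 2 then (1 : L) else 0)).Local v) × ((cmDatum L 1 (Matrix.of fun i j : Fin 1 => if i.val + j.val + 1 = 1 then (1 : L) else 0)).Local v))›.measurable_eq).trans (@BorelSpace.measurable_eq (((cmDatum L 2 (Matrix.of fun i j : Fin 2 => if i.val + j.val + 1 = 2 then (1 : L) else 0)).Local v) × ((cmDatum L 1 (Matrix.of fun i j : Fin 1 => if i.val + j.val + 1 = 1 then (1 : L) else 0)).Local v)) _ Prod.instMeasurableSpace Prod.borelSpace).symm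
  subst hmeq
  -- auxiliary Haar measures on the factors; `ν_H = r · ν′`, `ν′ = s′ · (ν₂ ⊗ ν₁)`
  let ν₂ : Measure ((cmDatum L 2 (Matrix.of fun i j : Fin 2 => if i.val + j.val + 1 = 2 then (1 : L) else 0)).Local v) := Measure.haar
  let ν₁ : Measure ((cmDatum L 1 (Matrix.of fun i j : Fin 1 => if i.val + j.val + 1 = 1 then (1 : L) else 0)).Local v) := Measure.haar
  haveI : SigmaFinite ν₂ := inferInstance
  haveI : SigmaFinite ν₁ := inferInstance
  haveI : (ν₂.prod ν₁).IsHaarMeasure := inferInstance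
  -- the flipped base point and its package
  have hbM : (w₀ * (u.1 : ↥(unitaryGroupOfForm (conjLocal L (IsCMField.complexConj L) v) (cmLocalForm L 2 v))) * w₀⁻¹) ∈ (cmBorelTriple L 2 v).M := (weylConj_mem_cmTorus_two L v w₀ hw₀ u.1)
  obtain ⟨hbN, hbNbar, hbexh⟩ := hdom u hu
  -- `ν₂(K_{2,n})·ν₁(K₁) = (ν₂ ⊗ ν₁)(K_{2,n} × K₁)`
  have hprod : (ν₂.prod ν₁).real ((((𝓘₂.K n).prod K₁ : Subgroup (↥(unitaryGroupOfForm (conjLocal L (IsCMField.complexConj L) v) (cmLocalForm L 2 v)) × ((cmDatum L 1 (Matrix.of fun i j : Fin 1 => if i.val + j.val + 1 = 1 then (1 : L) else 0)).Local v)))) : Set (↥(unitaryGroupOfForm (conjLocal L (IsCMField.complexConj L) v) (cmLocalForm L 2 v)) × ((cmDatum L 1 (Matrix.of fun i j : Fin 1 => if i.val + j.val + 1 = 1 then (1 : L) else 0)).Local v))) =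
      ν₂.real ((𝓘₂.K n : Subgroup ↥(unitaryGroupOfForm (conjLocal L (IsCMField.complexConj L) v) (cmLocalForm L 2 v))) : Set ↥(unitaryGroupOfForm (conjLocal L (IsCMField.complexConj L) v) (cmLocalForm L 2 v))) * ν₁.real (K₁ : Set ((cmDatum L 1 (Matrix.of fun i j : Fin 1 => if i.val + j.val + 1 = 1 then (1 : L) else 0)).Local v)) := by
    rw [measureReal_def, measureReal_def, measureReal_def, Subgroup.coe_prod]
    erw [Measure.prod_prod]
    rw [ENNReal.toReal_mul]
  -- the spectral data of the flipped shell (★ hF1H-ADAPTER), read in ②'s letters `ν′ := ν₂ ⊗ ν₁`, `N := #R₂ u`, `D := δ(b_u)`, `b₂ := u₁`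
  have hF1Hg : ∀ (χ₂ : ↥(torusU (conjLocal L (IsCMField.complexConj L) v) (cmLocalForm L 2 v)) →* ℂˣ) (_hχ₂ : Continuous fun t => ((χ₂ t : ℂˣ) : ℂ))
      (χ₁ : ((cmDatum L 1 (Matrix.of fun i j : Fin 1 => if i.val + j.val + 1 = 1 then (1 : L) else 0)).Local v) →* ℂˣ) (_hχ₁ : IsOpen ((χ₁.ker : Subgroup ((cmDatum L 1 (Matrix.of fun i j : Fin 1 => if i.val + j.val + 1 = 1 then (1 : L) else 0)).Local v)) : Set ((cmDatum L 1 (Matrix.of fun i j : Fin 1 => if i.val + j.val + 1 = 1 then (1 : L) else 0)).Local v))),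
      (cmPrincipalSeriesH L v χ₂ χ₁).smoothTrace (ν₂.prod ν₁) ((DoubleCoset.doubleCoset (((w₀ * (u.1 : ↥(unitaryGroupOfForm (conjLocal L (IsCMField.complexConj L) v) (cmLocalForm L 2 v))) * w₀⁻¹), u.2) : (↥(unitaryGroupOfForm (conjLocal L (IsCMField.complexConj L) v) (cmLocalForm L 2 v)) × ((cmDatum L 1 (Matrix.of fun i j : Fin 1 => if i.val + j.val + 1 = 1 then (1 : L) else 0)).Local v))) ((((𝓘₂.K n).prod K₁ : Subgroup (↥(unitaryGroupOfForm (conjLocal L (IsCMField.complexConj L) v) (cmLocalForm L 2 v)) × ((cmDatum L 1 (Matrix.of fun i j : Fin 1 => if i.val + j.val + 1 = 1 then (1 : L) else 0)).Local v)))) : Set (↥(unitaryGroupOfForm (conjLocal L (IsCMField.complexConj L) v) (cmLocalForm L 2 v)) × ((cmDatum L 1 (Matrix.of fun i j : Fin 1 => if i.val + j.val + 1 = 1 then (1 : L) else 0)).Local v))) (((𝓘₂.K n).prod K₁ : Subgroup (↥(unitaryGroupOfForm (conjLocal L (IsCMField.complexConj L) v) (cmLocalForm L 2 v)) × ((cmDatum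 L 1 (Matrix.of fun i j : Fin 1 => if i.val + j.val + 1 = 1 then (1 : L) else 0)).Local v))))).indicator fun _ => (1 : ℂ)) =
        if (∀ c ∈ (𝓘₂.K n).comap (cmBorelTriple L 2 v).M.subtype, χ₂ c = 1) ∧ (∀ k ∈ K₁, χ₁ k = 1)
        then (((ν₂.prod ν₁).real ((((𝓘₂.K n).prod K₁ : Subgroup (↥(unitaryGroupOfForm (conjLocal L (IsCMField.complexConj L) v) (cmLocalForm L 2 v)) × ((cmDatum L 1 (Matrix.of fun i j : Fin 1 => if i.val + j.val + 1 = 1 then (1 : L) else 0)).Local v)))) : Set (↥(unitaryGroupOfForm (conjLocal L (IsCMField.complexConj L) v) (cmLocalForm L 2 v)) × ((cmDatum L 1 (Matrix.of fun i j : Fin 1 => if i.val + j.val + 1 = 1 then (1 : L) else 0)).Local v))) : ℂ) * ((R₂ u).card : ℂ) * (((rootDeltaChar (cmBorelTriple L 2 v).P (Subgroup.inclusion (cmBorelTriple L 2 v).M_le ⟨(w₀ * (u.1 : ↥(unitaryGroupOfForm (conjLocal L (IsCMField.complexConj L) v) (cmLocalForm L 2 v))) * w₀⁻¹), (weylConj_mem_cmTorus_two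 L v w₀ hw₀ u.1)⟩)) : ℂˣ) : ℂ)) * ((χ₁ u.2 : ℂˣ) : ℂ) *
          (((χ₂ (⟨(w₀ * (u.1 : ↥(unitaryGroupOfForm (conjLocal L (IsCMField.complexConj L) v) (cmLocalForm L 2 v))) * w₀⁻¹), (weylConj_mem_cmTorus_two L v w₀ hw₀ u.1)⟩ : ↥(cmBorelTriple L 2 v).M) : ℂˣ) : ℂ) + 1 * ((χ₂ u.1 : ℂˣ) : ℂ))
        else 0 := by
    intro χ₂ hχ₂ χ₁ hχ₁
    rw [smoothTrace_cmPrincipalSeriesH_indicator_shell_eq_hF1H L v ν₂ ν₁ 𝓘₂ n hbM hbN hbNbar hbexh (hR₂ u hu) K₁ hK₁o hK₁c u.2 w₀ hw₀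
      (fun k hk => hKw _ hk) hW2c χ₂ hχ₂ χ₁ hχ₁, weylConj_weylConj_eq L v w₀ hw₀ u.1, hprod]
    push_cast
    split_ifs <;> ring
  -- ② at `(b₁, b₂, z₁) := (b_u, u₁, u₂)`
  have h2 := classOrbitalIntegralH_eq_of_prodHaar_spectral L v w hw νH hmH μT hK₁lev (ν₂.prod ν₁) (𝓘₂.K n) (𝓘₂.isOpen_K n) (𝓘₂.isCompact_K n)
    (R₂ u).card (((rootDeltaChar (cmBorelTriple L 2 v).P (Subgroup.inclusion (cmBorelTriple L 2 v).M_le ⟨(w₀ * (u.1 : ↥(unitaryGroupOfForm (conjLocal L (IsCMField.complexConj L) v) (cmLocalForm L 2 v))) * w₀⁻¹), (weylConj_mem_cmTorus_two L v w₀ hw₀ u.1)⟩)) : ℂˣ) : ℂ) K₁ hK₁o hK₁c (⟨(w₀ * (u.1 : ↥(unitaryGroupOfForm (conjLocal L (IsCMField.complexConj L) v) (cmLocalForm L 2 v))) * w₀⁻¹), (weylConj_mem_cmTorus_two L v w₀ hw₀ u.1)⟩ : ↥(cmBorelTriple L 2 v).M) u.1 u.2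
    ((DoubleCoset.doubleCoset (((w₀ * (u.1 : ↥(unitaryGroupOfForm (conjLocal L (IsCMField.complexConj L) v) (cmLocalForm L 2 v))) * w₀⁻¹), u.2) : (↥(unitaryGroupOfForm (conjLocal L (IsCMField.complexConj L) v) (cmLocalForm L 2 v)) × ((cmDatum L 1 (Matrix.of fun i j : Fin 1 => if i.val + j.val + 1 = 1 then (1 : L) else 0)).Local v))) ((((𝓘₂.K n).prod K₁ : Subgroup (↥(unitaryGroupOfForm (conjLocal L (IsCMField.complexConj L) v) (cmLocalForm L 2 v)) × ((cmDatum L 1 (Matrix.of fun i j : Fin 1 => if i.val + j.val + 1 = 1 then (1 : L) else 0)).Local v)))) : Set (↥(unitaryGroupOfForm (conjLocal L (IsCMField.complexConj L) v) (cmLocalForm L 2 v)) × ((cmDatum L 1 (Matrix.of fun i j : Fin 1 => if i.val + j.val + 1 = 1 then (1 : L) else 0)).Local v))) (((𝓘₂.K n).prod K₁ : Subgroup (↥(unitaryGroupOfForm (conjLocal L (IsCMField.complexConj L) v) (cmLocalForm L 2 v)) × ((cmDatum L 1 (Matrix.of fun i j : Fin 1 => if i.val + j.val + 1 = 1 then (1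 : L) else 0)).Local v))))).indicator fun _ => (1 : ℂ))
    (isLocSmooth_indicator_doubleCoset_prod (𝓘₂.isOpen_K n) (𝓘₂.isCompact_K n) hK₁o hK₁c _) hF1Hg γH d' hd' hreg hlt h01 tH htH hdH hb
  rw [smul_coe_eq_setOf, smul_coe_eq_setOf]
  exact h2

/-! ## §3 The clause for the ORIENTED shells (oriented coset first): `hOHj` of ★ p849876 at `s := F`, `C u := u • ↑S′` -/

open scoped Classical in
set_option maxHeartbeats 4000000 in  -- statement-level `whnf` on the CM carriers
set_option synthInstance.maxHeartbeats 400000 in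
/-- **«HSHELL-GLUE» = `hOHj` AT THE ORIENTED REPRESENTATIVES.**  Same frame as §2; conclusion: for every `u ∈ F` the ORIENTED shell `g u := 𝟙_{K_H (u₁, u₂) K_H}` satisfies the `hOHj`
clause of ★ `isLocalDeltaTransfer_doubleCosetSum_of_checklist` with `C u := u • ↑S′` (★ XIG-DATA's `hC` currency, `S′ = (T₂ ∩ K_{2,n}) × K₁`), `C′ u := (b_u, u₂) • ↑S′`,
`κ_H u := A_u`, `κ′ u := 1` — §2 moved to the oriented shell by ★ HOH-FLIP (`(w₀,1)` normalises `K_H`, ★ `weylElt_prod_one_mem_normalizer`; orbital integrals are class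
functions, ★ `classOrbitalIntegral_indicator_doubleCoset_eq_conj`) and `add_comm`. [cite: Rogawski1990, §4.3 p. 43; §4.9 (4.9.4) pp. 54–56; §12.7 Lemma 12.7.3 (proof) p. 195] -/
theorem hOHj_xig_of_hF1H
    [mHH : MeasurableSpace (((cmDatum L 2 (Matrix.of fun i j : Fin 2 => if i.val + j.val + 1 = 2 then (1 : L) else 0)).Local v) × ((cmDatum L 1 (Matrix.of fun i j : Fin 1 => if i.val + j.val + 1 = 1 then (1 : L) else 0)).Local v))] [BorelSpace (((cmDatum L 2 (Matrix.of fun i j : Fin 2 => if i.val + j.val + 1 = 2 then (1 : L) else 0)).Local v) × ((cmDatum L 1 (Matrix.of fun i j : Fin 1 => if i.val + j.val + 1 = 1 then (1 : L) else 0)).Local v))]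
    [∀ aH : (((cmDatum L 2 (Matrix.of fun i j : Fin 2 => if i.val + j.val + 1 = 2 then (1 : L) else 0)).Local v) × ((cmDatum L 1 (Matrix.of fun i j : Fin 1 => if i.val + j.val + 1 = 1 then (1 : L) else 0)).Local v)), MeasurableSpace ((((cmDatum L 2 (Matrix.of fun i j : Fin 2 => if i.val + j.val + 1 = 2 then (1 : L) else 0)).Local v) × ((cmDatum L 1 (Matrix.of fun i j : Fin 1 => if i.val + j.val + 1 = 1 then (1 : L) else 0)).Local v)) ⧸ Subgroup.centralizer ({aH} : Set (((cmDatum L 2 (Matrix.of fun i j : Fin 2 => if i.val + j.val + 1 = 2 then (1 : L) else 0)).Local v) × ((cmDatum L 1 (Matrix.of fun i j : Fin 1 => if i.val + j.val + 1 = 1 then (1 : L) else 0)).Local v))))]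
    [∀ aH : (((cmDatum L 2 (Matrix.of fun i j : Fin 2 => if i.val + j.val + 1 = 2 then (1 : L) else 0)).Local v) × ((cmDatum L 1 (Matrix.of fun i j : Fin 1 => if i.val + j.val + 1 = 1 then (1 : L) else 0)).Local v)), BorelSpace ((((cmDatum L 2 (Matrix.of fun i j : Fin 2 => if i.val + j.val + 1 = 2 then (1 : L) else 0)).Local v) × ((cmDatum L 1 (Matrix.of fun i j : Fin 1 => if i.val + j.val + 1 = 1 then (1 : L) else 0)).Local v)) ⧸ Subgroup.centralizer ({aH} : Set (((cmDatum L 2 (Matrix.of fun i j : Fin 2 => if i.val + j.val + 1 = 2 then (1 : L) else 0)).Local v) × ((cmDatum L 1 (Matrix.of fun i j : Fin 1 => if i.val + j.val + 1 = 1 then (1 : L) else 0)).Local v))))]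
    [MeasurableSpace ↥(unitaryGroupOfForm (conjLocal L (IsCMField.complexConj L) v) (cmLocalForm L 2 v))] [BorelSpace ↥(unitaryGroupOfForm (conjLocal L (IsCMField.complexConj L) v) (cmLocalForm L 2 v))] [MeasurableSpace ((cmDatum L 1 (Matrix.of fun i j : Fin 1 => if i.val + j.val + 1 = 1 then (1 : L) else 0)).Local v)] [BorelSpace ((cmDatum L 1 (Matrix.of fun i j : Fin 1 => if i.val + j.val + 1 = 1 then (1 : L) else 0)).Local v)]
    (w : PlacesOver L v) (hw : IsCMField.complexConj L • w.1 = w.1)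
    (νH : Measure (((cmDatum L 2 (Matrix.of fun i j : Fin 2 => if i.val + j.val + 1 = 2 then (1 : L) else 0)).Local v) × ((cmDatum L 1 (Matrix.of fun i j : Fin 1 => if i.val + j.val + 1 = 1 then (1 : L) else 0)).Local v))) [νH.IsHaarMeasure] [νH.IsMulRightInvariant]
    {mH : OrbitalMeasureFamily (((cmDatum L 2 (Matrix.of fun i j : Fin 2 => if i.val + j.val + 1 = 2 then (1 : L) else 0)).Local v) × ((cmDatum L 1 (Matrix.of fun i j : Fin 1 => if i.val + j.val + 1 = 1 then (1 : L) else 0)).Local v))} (hmH : mH.IsCanonical (IsLocalGRegular L v) νH)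
    (μT : Measure ↥(cmBorelTriple L 2 v).M) [μT.IsHaarMeasure]
    (hK₁lev : ∀ x : ((cmDatum L 1 (Matrix.of fun i j : Fin 1 => if i.val + j.val + 1 = 1 then (1 : L) else 0)).Local v), x ∈ cmLocalIntegralLevel L 1 (Matrix.of fun i j : Fin 1 => if i.val + j.val + 1 = 1 then (1 : L) else 0) v)
    (𝓘₂ : (cmBorelTriple L 2 v).IwahoriDatum) (n : ℕ)
    (K₁ : Subgroup ((cmDatum L 1 (Matrix.of fun i j : Fin 1 => if i.val + j.val + 1 = 1 then (1 : L) else 0)).Local v)) (hK₁o : IsOpen (K₁ : Set ((cmDatum L 1 (Matrix.of fun i j : Fin 1 => if i.val + j.val + 1 = 1 then (1 : L) else 0)).Local v))) (hK₁c : IsCompact (K₁ : Set ((cmDatum L 1 (Matrix.of fun i j : Fin 1 => if i.val + j.val + 1 = 1 then (1 : L) else 0)).Local v)))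
    (w₀ : ↥(unitaryGroupOfForm (conjLocal L (IsCMField.complexConj L) v) (cmLocalForm L 2 v))) (hw₀ : Units.val (w₀ : GL (Fin 2) (LocalRing L v)) = cmLocalForm L 2 v)
    (hKw : ∀ κ ∈ 𝓘₂.K n, w₀ * κ * w₀⁻¹ ∈ 𝓘₂.K n)
    (hW2c : haveI := locallyCompactSpace_cmBorelU L 2 v
      ∀ (χ₁ : (LocalRing L v)ˣ →* ℂˣ) (χ₂ : ↥(normOneUnits (conjLocal L (IsCMField.complexConj L) v)) →* ℂˣ),
        Continuous (fun x => ((χ₁ x : ℂˣ) : ℂ)) → Continuous (fun x => ((χ₂ x : ℂˣ) : ℂ)) →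
        FiniteDimensional ℂ ((cmBorelTriple L 2 v).restrict (cmPrincipalSeries L 2 v
            (torusCharPair (conjLocal L (IsCMField.complexConj L) v) (cmLocalForm L 2 v) (cmLocalForm_eq_over L 2 v) 0 χ₁ χ₂))).Coinvariants ∧
        Module.finrank ℂ ((cmBorelTriple L 2 v).restrict (cmPrincipalSeries L 2 v
            (torusCharPair (conjLocal L (IsCMField.complexConj L) v) (cmLocalForm L 2 v) (cmLocalForm_eq_over L 2 v) 0 χ₁ χ₂))).Coinvariants = 2 ∧
        ∃ ℓ : Submodule ℂ ((cmBorelTriple L 2 v).restrict (cmPrincipalSeries L 2 v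
            (torusCharPair (conjLocal L (IsCMField.complexConj L) v) (cmLocalForm L 2 v) (cmLocalForm_eq_over L 2 v) 0 χ₁ χ₂))).Coinvariants,
          Module.finrank ℂ ↥ℓ = 1 ∧
          (∀ (m : ↥(cmBorelTriple L 2 v).M), ∀ x ∈ ℓ,
            (cmPrincipalSeries L 2 v (torusCharPair (conjLocal L (IsCMField.complexConj L) v) (cmLocalForm L 2 v) (cmLocalForm_eq_over L 2 v) 0 χ₁ χ₂)).normalizedJacquet
                (cmBorelTriple L 2 v) m x =
              ((weylTorusCharPair (conjLocal L (IsCMField.complexConj L) v) (cmLocalForm L 2 v) (cmLocalForm_eq_over L 2 v) 0 χ₁ χ₂ m : ℂˣ) : ℂ) • x) ∧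
          (∀ (m : ↥(cmBorelTriple L 2 v).M) (x : ((cmBorelTriple L 2 v).restrict (cmPrincipalSeries L 2 v
              (torusCharPair (conjLocal L (IsCMField.complexConj L) v) (cmLocalForm L 2 v) (cmLocalForm_eq_over L 2 v) 0 χ₁ χ₂))).Coinvariants),
            (cmPrincipalSeries L 2 v (torusCharPair (conjLocal L (IsCMField.complexConj L) v) (cmLocalForm L 2 v) (cmLocalForm_eq_over L 2 v) 0 χ₁ χ₂)).normalizedJacquet
                (cmBorelTriple L 2 v) m x -
              ((torusCharPair (conjLocal L (IsCMField.complexConj L) v) (cmLocalForm L 2 v) (cmLocalForm_eq_over L 2 v) 0 χ₁ χ₂ m : ℂˣ) : ℂ) • x ∈ ℓ))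
    (F : Finset (↥(cmBorelTriple L 2 v).M × ((cmDatum L 1 (Matrix.of fun i j : Fin 1 => if i.val + j.val + 1 = 1 then (1 : L) else 0)).Local v)))
    (hdom : ∀ u ∈ F,
      (∀ x ∈ 𝓘₂.K n ⊓ (cmBorelTriple L 2 v).N, (w₀ * (u.1 : ↥(unitaryGroupOfForm (conjLocal L (IsCMField.complexConj L) v) (cmLocalForm L 2 v))) * w₀⁻¹) * x * (w₀ * (u.1 : ↥(unitaryGroupOfForm (conjLocal L (IsCMField.complexConj L) v) (cmLocalForm L 2 v))) * w₀⁻¹)⁻¹ ∈ 𝓘₂.K n) ∧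
      (∀ x ∈ 𝓘₂.K n ⊓ 𝓘₂.Nbar, (w₀ * (u.1 : ↥(unitaryGroupOfForm (conjLocal L (IsCMField.complexConj L) v) (cmLocalForm L 2 v))) * w₀⁻¹)⁻¹ * x * (w₀ * (u.1 : ↥(unitaryGroupOfForm (conjLocal L (IsCMField.complexConj L) v) (cmLocalForm L 2 v))) * w₀⁻¹) ∈ 𝓘₂.K n ⊓ 𝓘₂.Nbar) ∧
      (∀ x ∈ (cmBorelTriple L 2 v).N, ∃ m : ℕ, ∀ m', m ≤ m' → (w₀ * (u.1 : ↥(unitaryGroupOfForm (conjLocal L (IsCMField.complexConj L) v) (cmLocalForm L 2 v))) * w₀⁻¹) ^ m' * x * ((w₀ * (u.1 : ↥(unitaryGroupOfForm (conjLocal L (IsCMField.complexConj L) v) (cmLocalForm L 2 v))) * w₀⁻¹) ^ m')⁻¹ ∈ 𝓘₂.K n))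
    (R₂ : (↥(cmBorelTriple L 2 v).M × ((cmDatum L 1 (Matrix.of fun i j : Fin 1 => if i.val + j.val + 1 = 1 then (1 : L) else 0)).Local v)) → Finset ↥(unitaryGroupOfForm (conjLocal L (IsCMField.complexConj L) v) (cmLocalForm L 2 v)))
    (hR₂ : ∀ u ∈ F, IsLeftTransversal (𝓘₂.K n) (𝓘₂.K n ⊓ ConjAct.toConjAct (w₀ * (u.1 : ↥(unitaryGroupOfForm (conjLocal L (IsCMField.complexConj L) v) (cmLocalForm L 2 v))) * w₀⁻¹) • 𝓘₂.K n) (R₂ u)) :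
    ∀ u ∈ F, ∀ (γH : (((cmDatum L 2 (Matrix.of fun i j : Fin 2 => if i.val + j.val + 1 = 2 then (1 : L) else 0)).Local v) × ((cmDatum L 1 (Matrix.of fun i j : Fin 1 => if i.val + j.val + 1 = 1 then (1 : L) else 0)).Local v)))
      (d' : Fin 2 → (LocalRing L v)ˣ), glDiagonal 2 (LocalRing L v) d' = ((γH.1).val : GL (Fin 2) (LocalRing L v)) → IsLocalGRegular L v γH →
      Valued.v (((d' 1 : (LocalRing L v)ˣ) : LocalRing L v) w) < Valued.v (((d' 0 : (LocalRing L v)ˣ) : LocalRing L v) w) →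
      galAdicCompletionMap (L := L) (IsCMField.complexConj L) hw (((d' 0 : (LocalRing L v)ˣ) : LocalRing L v) w) * ((d' 1 : (LocalRing L v)ˣ) : LocalRing L v) w = 1 →
      ∀ (tH : ↥(cmBorelTriple L 2 v).M), (tH : ↥(unitaryGroupOfForm (conjLocal L (IsCMField.complexConj L) v) (cmLocalForm L 2 v))) = γH.1 →
      ∀ (hdH : glDiagonal 2 (LocalRing L v) d' = ((tH : ↥(unitaryGroupOfForm (conjLocal L (IsCMField.complexConj L) v) (cmLocalForm L 2 v))) : GL (Fin 2) (LocalRing L v)))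
        (hb : IsUnit ((((d' 0)⁻¹ * d' 1 : (LocalRing L v)ˣ) : LocalRing L v) - 1)),
      haveI := locallyCompactSpace_cmBorelU L 2 v
      classOrbitalIntegral mH ((DoubleCoset.doubleCoset (((u.1 : ↥(unitaryGroupOfForm (conjLocal L (IsCMField.complexConj L) v) (cmLocalForm L 2 v))), u.2) : (↥(unitaryGroupOfForm (conjLocal L (IsCMField.complexConj L) v) (cmLocalForm L 2 v)) × ((cmDatum L 1 (Matrix.of fun i j : Fin 1 => if i.val + j.val + 1 = 1 then (1 : L) else 0)).Local v))) ((((𝓘₂.K n).prod K₁ : Subgroup (↥(unitaryGroupOfForm (conjLocal L (IsCMField.complexConj L) v) (cmLocalForm L 2 v)) × ((cmDatum L 1 (Matrix.of fun i j : Fin 1 => if i.val + j.val + 1 = 1 then (1 : L) else 0)).Local v)))) : Set (↥(unitaryGroupOfForm (conjLocal L (IsCMField.complexConj L) v) (cmLocalForm L 2 v)) × ((cmDatum L 1 (Matrix.of fun i j : Fin 1 => if i.val + j.val + 1 = 1 then (1 : L) else 0)).Local v))) (((𝓘₂.K n).prod K₁ : Subgroup (↥(unitaryGroupOfForm (conjLocal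 L (IsCMField.complexConj L) v) (cmLocalForm L 2 v)) × ((cmDatum L 1 (Matrix.of fun i j : Fin 1 => if i.val + j.val + 1 = 1 then (1 : L) else 0)).Local v))))).indicator fun _ => (1 : ℂ)) (ConjClasses.mk (((tH : ↥(unitaryGroupOfForm (conjLocal L (IsCMField.complexConj L) v) (cmLocalForm L 2 v))) :
          ((cmDatum L 2 (Matrix.of fun i j : Fin 2 => if i.val + j.val + 1 = 2 then (1 : L) else 0)).Local v)), γH.2)) =
        ((rootDeltaChar (cmBorelTriple L 2 v).P ⟨(tH : ↥(unitaryGroupOfForm (conjLocal L (IsCMField.complexConj L) v) (cmLocalForm L 2 v))), (cmBorelTriple L 2 v).M_le tH.2⟩ : ℂˣ) : ℂ)⁻¹ *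
          (((letI : MeasurableSpace (LocalRing L v) := borel _; haveI : BorelSpace (LocalRing L v) := ⟨rfl⟩
            haveI : SecondCountableTopology (LocalRing L v) := secondCountableTopology_localRing (E := L) v
            ((HeisRing.skewModulus (conjLocal L (IsCMField.complexConj L) v) (continuous_conjLocal L (IsCMField.complexConj L) v) hb.unit
              (LineRing.map_unit_torusScalar_sub_one_two (conjLocal L (IsCMField.complexConj L) v) (cmLocalForm_eq_over L 2 v)
                (⟨(tH : ↥(unitaryGroupOfForm (conjLocal L (IsCMField.complexConj L) v) (cmLocalForm L 2 v))), tH.2⟩ :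
                  ↥(torusU (conjLocal L (IsCMField.complexConj L) v) (cmLocalForm L 2 v))) hdH hb))⁻¹ : ℝ≥0)) : ℝ) : ℂ) *
          ((((νH.real ((((𝓘₂.K n).prod (⊤ : Subgroup ((cmDatum L 1 (Matrix.of fun i j : Fin 1 => if i.val + j.val + 1 = 1 then (1 : L) else 0)).Local v)) : Subgroup (↥(unitaryGroupOfForm (conjLocal L (IsCMField.complexConj L) v) (cmLocalForm L 2 v)) × ((cmDatum L 1 (Matrix.of fun i j : Fin 1 => if i.val + j.val + 1 = 1 then (1 : L) else 0)).Local v))) : Set (↥(unitaryGroupOfForm (conjLocal L (IsCMField.complexConj L) v) (cmLocalForm L 2 v)) × ((cmDatum L 1 (Matrix.of fun i j : Fin 1 => if i.val + j.val + 1 = 1 then (1 : L) else 0)).Local v)))) : ℝ) : ℂ) * ((R₂ u).card : ℂ) * (((rootDeltaChar (cmBorelTriple L 2 v).P (Subgroup.inclusion (cmBorelTriple L 2 v).M_le ⟨(w₀ * (u.1 : ↥(unitaryGroupOfForm (conjLocal L (IsCMField.complexConj L) v) (cmLocalForm L 2 v))) * w₀⁻¹), (weylConj_mem_cmTorus_two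 L v w₀ hw₀ u.1)⟩)) : ℂˣ) : ℂ) *
              ((μT.real {t : ↥(cmBorelTriple L 2 v).M | (t : ↥(unitaryGroupOfForm (conjLocal L (IsCMField.complexConj L) v) (cmLocalForm L 2 v))) ∈ cmLocalIntegralLevel L 2 (Matrix.of fun i j : Fin 2 => if i.val + j.val + 1 = 2 then (1 : L) else 0) v} : ℝ) : ℂ) /
              ((μT.real ((((𝓘₂.K n).comap (cmBorelTriple L 2 v).M.subtype : Subgroup ↥(cmBorelTriple L 2 v).M)) : Set ↥(cmBorelTriple L 2 v).M) : ℝ) : ℂ)) * (((u • ((((𝓘₂.K n).comap (cmBorelTriple L 2 v).M.subtype).prod K₁ : Subgroup (↥(cmBorelTriple L 2 v).M × ((cmDatum L 1 (Matrix.of fun i j : Fin 1 => if i.val + j.val + 1 = 1 then (1 : L) else 0)).Local v))) : Set (↥(cmBorelTriple L 2 v).M × ((cmDatum L 1 (Matrix.of fun i j : Fin 1 => if i.val + j.val + 1 = 1 then (1 : L) else 0)).Local v))))).indicator (fun _ => (1 : ℂ)) (tH, γH.2) + 1 * (((((⟨(w₀ * (u.1 : ↥(unitaryGroupOfForm (conjLocal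 L (IsCMField.complexConj L) v) (cmLocalForm L 2 v))) * w₀⁻¹), (weylConj_mem_cmTorus_two L v w₀ hw₀ u.1)⟩ : ↥(cmBorelTriple L 2 v).M), u.2) : (↥(cmBorelTriple L 2 v).M × ((cmDatum L 1 (Matrix.of fun i j : Fin 1 => if i.val + j.val + 1 = 1 then (1 : L) else 0)).Local v))) • ((((𝓘₂.K n).comap (cmBorelTriple L 2 v).M.subtype).prod K₁ : Subgroup (↥(cmBorelTriple L 2 v).M × ((cmDatum L 1 (Matrix.of fun i j : Fin 1 => if i.val + j.val + 1 = 1 then (1 : L) else 0)).Local v))) : Set (↥(cmBorelTriple L 2 v).M × ((cmDatum L 1 (Matrix.of fun i j : Fin 1 => if i.val + j.val + 1 = 1 then (1 : L) else 0)).Local v))))).indicator (fun _ => (1 : ℂ)) (tH, γH.2))) := by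
  intro u hu γH d' hd' hreg hlt h01 tH htH hdH hb
  have hwn := weylElt_prod_one_mem_normalizer L v w₀ hw₀ (𝓘₂.K n) K₁ hKw
  refine (classOrbitalIntegral_indicator_doubleCoset_eq_conj L v hmH.isAdmissibleOn (((𝓘₂.K n).prod K₁ : Subgroup (↥(unitaryGroupOfForm (conjLocal L (IsCMField.complexConj L) v) (cmLocalForm L 2 v)) × ((cmDatum L 1 (Matrix.of fun i j : Fin 1 => if i.val + j.val + 1 = 1 then (1 : L) else 0)).Local v)))) hwn _ _
      (prod_weylElt_one_conj w₀ (u.1 : ↥(unitaryGroupOfForm (conjLocal L (IsCMField.complexConj L) v) (cmLocalForm L 2 v))) u.2) γH tH htH hreg).trans ?_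
  refine (hShell_xig_of_hF1H L v w hw νH hmH μT hK₁lev 𝓘₂ n K₁ hK₁o hK₁c w₀ hw₀ hKw hW2c F hdom R₂ hR₂ u hu γH d' hd' hreg hlt h01 tH htH hdH hb).trans ?_
  ring

end Summit.HodgeConjecture.HodgeConjecture.Cruxes.H413.F0P3cStCharTSHshellGlue

end
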